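/-
Copyright (c) 2026 the pub-hodgecm-mathlib formalisation cell (harness21).  Prover seat hodgecm-mathlib-K2E4-p14 (g2), Track B «K2-LIT» ∕ h413,
ENGINE E4 unit U6 `ArchLimitConstant` — socket #10♯ `sig_K2E4ExplicitArchConstantPhaseSigned` PAID BY NAME (dealer K2E4-plan (g0) cut 2026-09-03T23:49:50Z:
★ p855349 (K2E4-p15) ∘ ★ (C) p855849 (this seat) ∘ ★ (B) p855851 + glue (K2E4-p13) ∘ ★ (A) p855819 (K2E4-p09)).  2026-09-04.
-/
import Summits.HodgeConjecture.HodgeConjecture.Theorems.K2E4ExplicitKappaSignOfSockets                       -- ★ p854898: the sockets' common FRAME (letters' vocabulary)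
import Summits.HodgeConjecture.HodgeConjecture.Theorems.K2E4ExplicitArchConstantPhaseSignedOfSignLaw         -- ★ p855349 (K2E4-p15): #10♯ ⟸ «signed #9» `explicitArchConstantPhaseSigned_of_signLaw`
import Summits.HodgeConjecture.HodgeConjecture.Theorems.K2E4ExplicitArchSingularTransferOfPackagesSigned     -- ★ p855819 (K2E4-p09): (A) the SIGNED #9 assembly with the frame export
import Summits.HodgeConjecture.HodgeConjecture.Theorems.K2E4ArchHStepDataSigned                             -- ★ (K2E4-p13): (b) `hStepDataSigned_nonempty` (`C_w < 0`)
import Summits.HodgeConjecture.HodgeConjecture.Theorems.K2E4ArchGPrimeDataSigned                            -- ★ p855677 (K2E4-p09): signed packer `gPrimeDataSigned_nonempty` (over ★ p855645, this seat)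
import Summits.HodgeConjecture.HodgeConjecture.Theorems.K2E4ArchSingularTopFormTransport                     -- ★ p855158 (K2E4-p09): `topFormTransport` (hTr)
import Summits.HodgeConjecture.HodgeConjecture.Theorems.K2E4ArchFramePairIdentification                      -- ★ p855851 (K2E4-p13): (B) `γ₀′`, `Φ_P t = γ₀′ ⊗ 1`, `h₀ = γ_H ⊗ 1`
import Summits.HodgeConjecture.HodgeConjecture.Theorems.K2E4SignedNineOfFrameExport                          -- ★ p855849 (this seat): (C) frame export ⟹ sign law
import HarnessLib
/-!
# Socket #10♯ `sig_K2E4ExplicitArchConstantPhaseSigned` BY NAME — the SIGNED archimedean phase of Prop. 8.2.1 (a):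
# `cinf · Δ‴_∞(γ_H ⊗ 1, γ₀ ⊗ 1) = (−1)^{#{w : W₂(γ₀) ⊗_w ℂ definite}} · r`, `r > 0` (Rogawski 1990, Prop. 8.2.1 proof pp. 118–119 «differs by a sign»)
Cell `pub/hodgecm-mathlib`, crux H413 = `stmt-HodgeConjecture-24833`, route of record `HCCMUnconditional`; Track B «K2-LIT», line `K2_E4_SingularTransferKappaSign`,
socket module `Cruxes/H413/Lines/K2_E4_SingularTransferKappaSignSigsArchLimitConstant.lean` :324–:381 (statement pasted VERBATIM, extracted programmatically).  Prover seat
hodgecm-mathlib-K2E4-p14 (g2) — ASSEMBLER per the dealer's cut 23:49:50Z.  THEOREMS ONLY (no `def`, no `instance`, no notation, no `sorry`); lane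
`--supports stmt-HodgeConjecture-24833 --as helper`.
THE CHAIN (every link ★): (A) ★ p855819 `explicitArchSingularTransfer_of_packages_signed` (K2E4-p09) — the #9 assembly ★ p855083 re-run with the SIGNED inputs (b) ★
`hStepDataSigned_nonempty` (`C_w < 0`, K2E4-p13, over the signed Harish-Chandra constant ★ `ArchRankOneLimitFormulaGroupSigned`) and (c) ★ `gPrimeDataSigned_nonempty`
(K2E4-p09, over ★ p855645 `exists_gState_univ_eq_signed`, this seat) and ★ `topFormTransport`, exporting at its internal rational diagonal frame `(P, α′)`:
`cinf = (−1)^{|W|} · (Π_w sgn Re σ_w(α′₀α′₂)) · s · conj(Δ‴_∞(h₀, y))`, `s > 0`, `↑y = σ(P)·t_{α′}(σe₁,σe₂,σe₁)·σ(P)⁻¹`, plus the (κ-arch) identity; (B) ★ p855851 +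
★ `K2E4ArchFramePairSemiregular` (K2E4-p13): `y = γ₀′ ⊗ 1` for the RATIONAL semiregular `γ₀′ = P·diag(e₁,e₂,e₁)·P⁻¹ ∈ U(H′)(L)`, `h₀ = γ_H ⊗ 1`, and the pinned frame
`(P·(0 2 1), (α′₀, α′₂, α′₁))` of `γ₀′` with its semiregularity data; (C) ★ p855849 `signLaw_of_frameExport` (this seat, over ★ p855310 K2E4-p15): at `γ₀′`,
`(−1)^{|W|}·Π sgn σ(d₀d₁) = (−1)^{N(γ₀′)}`, `Δ‴_∞ = τ·D·K`, `ε(H′)·K = (−1)^N`, `ε² = 1` ⟹ `cinf = ε(H′)·(s·D_∞)·conj τ_∞(γ_H ⊗ 1)` — ★ p855349's «signed #9»; then ★ p855349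
`explicitArchConstantPhaseSigned_of_signLaw` (K2E4-p15) gives #10♯'s tail verbatim.
HONEST LABEL: HC_CM is proved only modulo the 7 printed citations (2 remaining named inputs: hLiu418 = stmt-HodgeConjecture-24832, h413 = stmt-HodgeConjecture-24833) until rung 0 closes;
this file pays socket #10♯ of the E4 line (ALC ED. 9 tie) and nothing above it; with it socket #14 ∕ tier-0 B_R ∕ O7-by-value wait on ‹S› (E3 road J) ALONE.
## References
* [Rogawski1990] J. D. Rogawski, *Automorphic Representations of Unitary Groups in Three Variables*, Ann. of Math. Stud. 123 (1990), §8.2 Prop. 8.2.1 (a) p. 118 and its proof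
  pp. 118–119 (held e-text book:rogawski1990 p0118.txt:L3 «there is a non-zero constant c», L32 «the constant in the limit formula for H′ differs by a sign from that in the limit
  formula for H»); §4.9 p. 55; §14.5 Lemma 14.5.2 (b) pp. 238–239; §14.6 p. 242.
* [Kottwitz1983] R. E. Kottwitz, *Sign changes in harmonic analysis on reductive groups*, Trans. Amer. Math. Soc. 278 (1983), §1.
* [LanglandsShelstad1987] R. P. Langlands, D. Shelstad, *On the definition of transfer factors*, Math. Ann. 278 (1987), §2, §6.4.
-/
set_option autoImplicit false
-- the mandated namespace repeats the single-problem summit's segment (`HodgeConjecture.HodgeConjecture`)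
set_option linter.dupNamespace false
noncomputable section
open MeasureTheory Measure NumberField NumberField.InfinitePlace NumberField.mixedEmbedding IsDedekindDomain
open Literature.MeasureTheory.Group Literature.MeasureTheory.RestrictedProduct
open Literature.Topology.RestrictedProduct Literature.Topology.Algebra.RestrictedProduct
open Literature.NumberTheory.Rogawski1990 Literature.NumberTheory.Automorphic Literature.NumberTheory.GaloisRepresentations
open Literature.AlgebraicGeometry.ShimuraVarieties (unitaryGroup hermForm)
open Matrix Polynomial
open Summit.HodgeConjecture.HodgeConjecture.Cruxes.H413.K2E4ArchFramePairIdentification (det_diagonal_ne_zero_of_complexConj_mul_self conj_diagonal_mem_unitaryGroup)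
open scoped Matrix MatrixGroups RestrictedProduct NNReal ENNReal ComplexConjugate Classical
namespace Summit.HodgeConjecture.HodgeConjecture.Cruxes.H413.K2E4ExplicitArchConstantPhaseSigned

/-! ## §1 The rational semiregular element `γ₀′ = P·diag(e₁,e₂,e₁)·P⁻¹` of the frame export and its pinned frame (glue for (B) → (C)) -/

section Glue

variable (L : Type) [Field L] [NumberField L] [IsCMField L] (H' : Matrix (Fin 3) (Fin 3) L)
  (hherm : (H'.map (cmConjRingHom L)).transpose = H')
  (hanis : ∀ x : Fin 3 → L, hermForm (cmConjRingHom L) H' x x = 0 → x = 0)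
  (P : GL (Fin 3) L) (α' : Fin 3 → L) (hP : formCongr (cmConjRingHom L) P H' = Matrix.diagonal α')
  (e₁ e₂ : L) (h₁ : (IsCMField.complexConj L e₁ : L) * e₁ = 1) (h₂ : (IsCMField.complexConj L e₂ : L) * e₂ = 1) (hne : e₁ ≠ e₂)

include h₁ h₂ in
/-- Unit-circle entries of `diag(e₁, e₂, e₁)` (`c(eᵢ)·eᵢ = 1`). [cite: Rogawski1990, §8.2 p. 118] -/
theorem hd_aba : ∀ i, (IsCMField.complexConj L (![e₁, e₂, e₁] i) : L) * ![e₁, e₂, e₁] i = 1 := by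
  intro i; fin_cases i
  · exact h₁
  · exact h₂
  · exact h₁

include hne in
/-- **(i)(ii)(iii) SEMIREGULARITY of `γ₀′ = P·diag(e₁,e₂,e₁)·P⁻¹`**: `(γ₀′ − e₁)(γ₀′ − e₂) = 0`, `γ₀′` is not central (`e₁ ≠ e₂`), `charpoly γ₀′ = (X − e₁)²(X − e₂)` (conjugation-invariance of the characteristic polynomial). [cite: Rogawski1990, §3.8 Prop. 3.8.1 (a) p. 30; §8.2 p. 118] -/
theorem semiregular_conj_diagonal (γ₁ : (UnitaryGroup.cmDatum L 3 H').Rational)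
    (hγ₁ : (((γ₁ : unitaryGroup (cmConjRingHom L) H').val : GL (Fin 3) L) : Matrix (Fin 3) (Fin 3) L) =
      (P : Matrix (Fin 3) (Fin 3) L) * Matrix.diagonal ![e₁, e₂, e₁] * ((P⁻¹ : GL (Fin 3) L) : Matrix (Fin 3) (Fin 3) L)) :
    ((((γ₁ : unitaryGroup (cmConjRingHom L) H').val : GL (Fin 3) L) : Matrix (Fin 3) (Fin 3) L) - e₁ • (1 : Matrix (Fin 3) (Fin 3) L)) *
        ((((γ₁ : unitaryGroup (cmConjRingHom L) H').val : GL (Fin 3) L) : Matrix (Fin 3) (Fin 3) L) - e₂ • (1 : Matrix (Fin 3) (Fin 3) L)) = 0 ∧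
      (¬ ∃ ζ : L, (((γ₁ : unitaryGroup (cmConjRingHom L) H').val : GL (Fin 3) L) : Matrix (Fin 3) (Fin 3) L) = ζ • (1 : Matrix (Fin 3) (Fin 3) L)) ∧
      (((γ₁ : unitaryGroup (cmConjRingHom L) H').val : GL (Fin 3) L) : Matrix (Fin 3) (Fin 3) L).charpoly =
        (Polynomial.X - Polynomial.C e₁) ^ 2 * (Polynomial.X - Polynomial.C e₂) := by
  have hPinv : ((P⁻¹ : GL (Fin 3) L) : Matrix (Fin 3) (Fin 3) L) * (P : Matrix (Fin 3) (Fin 3) L) = 1 := by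
    rw [← Units.val_mul, inv_mul_cancel, Units.val_one]
  have hPinv' : (P : Matrix (Fin 3) (Fin 3) L) * ((P⁻¹ : GL (Fin 3) L) : Matrix (Fin 3) (Fin 3) L) = 1 := by
    rw [← Units.val_mul, mul_inv_cancel, Units.val_one]
  refine ⟨?_, ?_, ?_⟩
  · have hconj : ∀ e : L, ((((γ₁ : unitaryGroup (cmConjRingHom L) H').val : GL (Fin 3) L) : Matrix (Fin 3) (Fin 3) L) - e • (1 : Matrix (Fin 3) (Fin 3) L)) =
        (P : Matrix (Fin 3) (Fin 3) L) * (Matrix.diagonal ![e₁, e₂, e₁] - e • (1 : Matrix (Fin 3) (Fin 3) L)) * ((P⁻¹ : GL (Fin 3) L) : Matrix (Fin 3) (Fin 3) L) := by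
      intro e
      rw [hγ₁, Matrix.mul_sub, Matrix.sub_mul, Matrix.mul_smul, Matrix.mul_one, Matrix.smul_mul, hPinv']
    have hDD : (Matrix.diagonal ![e₁, e₂, e₁] - e₁ • (1 : Matrix (Fin 3) (Fin 3) L)) * (Matrix.diagonal ![e₁, e₂, e₁] - e₂ • (1 : Matrix (Fin 3) (Fin 3) L)) = 0 := by
      rw [Matrix.smul_one_eq_diagonal, Matrix.smul_one_eq_diagonal, Matrix.diagonal_sub, Matrix.diagonal_sub, Matrix.diagonal_mul_diagonal, ← Matrix.diagonal_zero]
      congr 1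
      funext i; fin_cases i <;> simp
    rw [hconj e₁, hconj e₂]
    calc (P : Matrix (Fin 3) (Fin 3) L) * (Matrix.diagonal ![e₁, e₂, e₁] - e₁ • (1 : Matrix (Fin 3) (Fin 3) L)) * ((P⁻¹ : GL (Fin 3) L) : Matrix (Fin 3) (Fin 3) L) *
          ((P : Matrix (Fin 3) (Fin 3) L) * (Matrix.diagonal ![e₁, e₂, e₁] - e₂ • (1 : Matrix (Fin 3) (Fin 3) L)) * ((P⁻¹ : GL (Fin 3) L) : Matrix (Fin 3) (Fin 3) L))
        = (P : Matrix (Fin 3) (Fin 3) L) * ((Matrix.diagonal ![e₁, e₂, e₁] - e₁ • (1 : Matrix (Fin 3) (Fin 3) L)) *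
            (((P⁻¹ : GL (Fin 3) L) : Matrix (Fin 3) (Fin 3) L) * (P : Matrix (Fin 3) (Fin 3) L)) *
            (Matrix.diagonal ![e₁, e₂, e₁] - e₂ • (1 : Matrix (Fin 3) (Fin 3) L))) * ((P⁻¹ : GL (Fin 3) L) : Matrix (Fin 3) (Fin 3) L) := by
          simp only [Matrix.mul_assoc]
      _ = 0 := by rw [hPinv, Matrix.mul_one, hDD, Matrix.mul_zero, Matrix.zero_mul]
  · rintro ⟨ζ, hζ⟩
    have hD : Matrix.diagonal ![e₁, e₂, e₁] = ζ • (1 : Matrix (Fin 3) (Fin 3) L) := by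
      calc Matrix.diagonal ![e₁, e₂, e₁]
          = (((P⁻¹ : GL (Fin 3) L) : Matrix (Fin 3) (Fin 3) L) * (P : Matrix (Fin 3) (Fin 3) L)) * Matrix.diagonal ![e₁, e₂, e₁] *
              (((P⁻¹ : GL (Fin 3) L) : Matrix (Fin 3) (Fin 3) L) * (P : Matrix (Fin 3) (Fin 3) L)) := by rw [hPinv, Matrix.one_mul, Matrix.mul_one]
        _ = ((P⁻¹ : GL (Fin 3) L) : Matrix (Fin 3) (Fin 3) L) * ((P : Matrix (Fin 3) (Fin 3) L) * Matrix.diagonal ![e₁, e₂, e₁] * ((P⁻¹ : GL (Fin 3) L) : Matrix (Fin 3) (Fin 3) L)) *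
              (P : Matrix (Fin 3) (Fin 3) L) := by simp only [Matrix.mul_assoc]
        _ = ((P⁻¹ : GL (Fin 3) L) : Matrix (Fin 3) (Fin 3) L) * (ζ • (1 : Matrix (Fin 3) (Fin 3) L)) * (P : Matrix (Fin 3) (Fin 3) L) := by rw [← hγ₁, hζ]
        _ = ζ • (1 : Matrix (Fin 3) (Fin 3) L) := by rw [Matrix.mul_smul, Matrix.mul_one, Matrix.smul_mul, hPinv]
    have h00 := congrFun (congrFun hD 0) 0
    have h11 := congrFun (congrFun hD 1) 1
    simp only [Matrix.diagonal_apply_eq, Matrix.smul_apply, Matrix.one_apply_eq, smul_eq_mul, mul_one, Matrix.cons_val_zero, Matrix.cons_val_one] at h00 h11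
    exact hne (h00.trans h11.symm)
  · rw [hγ₁, Matrix.coe_units_inv, Matrix.charpoly_units_conj, Matrix.charpoly_diagonal, Fin.prod_univ_three]
    simp only [Matrix.cons_val_zero, Matrix.cons_val_one, Matrix.cons_val_two, Matrix.head_cons, Matrix.tail_cons]
    ring

include hherm hanis hP in
/-- **(iv)(v) THE FRAME VALUES ARE REAL AND NON-ZERO**: `σ(α′ᵢ) = α′ᵢ` (the congruent form `σ(P)ᵀ H′ P = diag α′` of the σ-hermitian `H′` is σ-hermitian) and `α′ᵢ ≠ 0` (anisotropy transported by `P`, ★ `anisotropic_formCongr_cm`, tested on the basis vector `eᵢ`). [cite: Rogawski1990, §3.8 Prop. 3.8.1 (d) p. 30] -/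
theorem frame_entries_real_ne_zero : (∀ j, cmConjRingHom L (α' j) = α' j) ∧ (∀ j, α' j ≠ 0) := by
  constructor
  · intro j
    have hH' : H'.map (cmConjRingHom L) = H'ᵀ := by rw [← hherm, Matrix.transpose_transpose, hherm]
    have h1 : (((P : Matrix (Fin 3) (Fin 3) L).map (cmConjRingHom L))ᵀ).map (cmConjRingHom L) = (P : Matrix (Fin 3) (Fin 3) L)ᵀ := by
      ext i j
      simp [cmConjRingHom_apply, IsCMField.complexConj_apply_apply]
    have key : (Matrix.diagonal α').map (cmConjRingHom L) = (Matrix.diagonal α')ᵀ := by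
      rw [← hP]
      change (((P : Matrix (Fin 3) (Fin 3) L).map (cmConjRingHom L))ᵀ * H' * (P : Matrix (Fin 3) (Fin 3) L)).map (cmConjRingHom L) =
        (((P : Matrix (Fin 3) (Fin 3) L).map (cmConjRingHom L))ᵀ * H' * (P : Matrix (Fin 3) (Fin 3) L))ᵀ
      rw [Matrix.map_mul, Matrix.map_mul, h1, hH', Matrix.transpose_mul, Matrix.transpose_mul, Matrix.transpose_transpose, Matrix.mul_assoc]
    have h := congrFun (congrFun key j) j
    simpa [Matrix.diagonal_apply_eq] using h
  · intro j hj
    have han := UnitaryGroup.anisotropic_formCongr_cm L P hanis (Pi.single j (1 : L))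
    rw [hP] at han
    have hval : hermForm (cmConjRingHom L) (Matrix.diagonal α') (Pi.single j (1 : L)) (Pi.single j (1 : L)) = α' j := by
      unfold hermForm
      rw [Matrix.diagonal_mulVec_single, dotProduct_single]
      simp
    have hzero : (Pi.single j (1 : L) : Fin 3 → L) = 0 := han (by rw [hval, hj])
    have hj1 := congrFun hzero j
    simp only [Pi.single_eq_same, Pi.zero_apply] at hj1
    exact one_ne_zero hj1

include hP in
/-- **(vi)(vii) THE PINNED FRAME OF `γ₀′`**: with the transposition matrix `S` of `(1 2)` (an involution, `σ(S) = S = Sᵀ`), `P′ = P·S` satisfies `σ(P′)ᵀ H′ P′ = diag(α′₀, α′₂, α′₁)` and `γ₀′·P′ = P′·diag(e₁, e₁, e₂)` — ★ p855310's frame convention (the `e₂`-eigenline last). [cite: Rogawski1990, §3.8 Prop. 3.8.1 (a) p. 30; §8.2 p. 118] -/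
theorem frame_perm (γ₁ : (UnitaryGroup.cmDatum L 3 H').Rational)
    (hγ₁ : (((γ₁ : unitaryGroup (cmConjRingHom L) H').val : GL (Fin 3) L) : Matrix (Fin 3) (Fin 3) L) =
      (P : Matrix (Fin 3) (Fin 3) L) * Matrix.diagonal ![e₁, e₂, e₁] * ((P⁻¹ : GL (Fin 3) L) : Matrix (Fin 3) (Fin 3) L)) :
    ∃ P' : GL (Fin 3) L,
      (((P' : Matrix (Fin 3) (Fin 3) L)).map (cmConjRingHom L))ᵀ * H' * (P' : Matrix (Fin 3) (Fin 3) L) = Matrix.diagonal ![α' 0, α' 2, α' 1] ∧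
      ((((γ₁ : unitaryGroup (cmConjRingHom L) H').val : GL (Fin 3) L) : Matrix (Fin 3) (Fin 3) L)) * (P' : Matrix (Fin 3) (Fin 3) L) =
        (P' : Matrix (Fin 3) (Fin 3) L) * Matrix.diagonal ![e₁, e₁, e₂] := by
  -- the transposition matrix `S` of `(1 2)` on `Fin 3`: an involution, fixed by `σ`, symmetric
  set σ : Equiv.Perm (Fin 3) := Equiv.swap 1 2 with hσ
  set S : Matrix (Fin 3) (Fin 3) L := σ.toPEquiv.toMatrix with hS
  have hσσ : (σ : Fin 3 → Fin 3) ∘ σ = id := funext fun x => Equiv.swap_apply_self _ _ _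
  have hσsymm : σ.symm = σ := Equiv.symm_swap _ _
  have hconjS : ∀ d : Fin 3 → L, S * Matrix.diagonal d * S = Matrix.diagonal (d ∘ σ) := by
    intro d
    rw [hS, PEquiv.toMatrix_toPEquiv_mul, PEquiv.mul_toMatrix_toPEquiv, hσsymm, Matrix.submatrix_submatrix, Function.comp_id, Function.id_comp,
      Matrix.submatrix_diagonal_equiv]
  have hSS : S * S = 1 := by
    have h := hconjS (fun _ => 1)
    rwa [Matrix.diagonal_one, Matrix.mul_one, show ((fun _ : Fin 3 => (1 : L)) ∘ σ) = fun _ => 1 from rfl, Matrix.diagonal_one] at h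
  have hST : Sᵀ = S := by
    rw [hS, ← PEquiv.toMatrix_symm, ← Equiv.toPEquiv_symm, hσsymm]
  have hSmap : S.map (cmConjRingHom L) = S := by
    ext i j
    simp [hS, PEquiv.toMatrix_apply, apply_ite (cmConjRingHom L)]
  have hσ0 : σ 0 = 0 := by decide
  have hσ1 : σ 1 = 2 := by decide
  have hσ2 : σ 2 = 1 := by decide
  have hpermα : (α' ∘ σ) = ![α' 0, α' 2, α' 1] := by
    funext i; fin_cases i <;> simp [hσ0, hσ1, hσ2]
  have hperme : (![e₁, e₂, e₁] ∘ σ) = ![e₁, e₁, e₂] := by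
    funext i; fin_cases i <;> simp [hσ0, hσ1, hσ2]
  have hPinv : ((P⁻¹ : GL (Fin 3) L) : Matrix (Fin 3) (Fin 3) L) * (P : Matrix (Fin 3) (Fin 3) L) = 1 := by
    rw [← Units.val_mul, inv_mul_cancel, Units.val_one]
  refine ⟨P * ⟨S, S, hSS, hSS⟩, ?_, ?_⟩
  · -- `σ(P S)ᵀ H′ (P S) = S (σ(P)ᵀ H′ P) S = S·diag α′·S = diag(α′ ∘ (1 2))`
    have hP' : ((P : Matrix (Fin 3) (Fin 3) L).map (cmConjRingHom L))ᵀ * H' * (P : Matrix (Fin 3) (Fin 3) L) = Matrix.diagonal α' := hP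
    rw [Units.val_mul, show (((⟨S, S, hSS, hSS⟩ : GL (Fin 3) L)) : Matrix (Fin 3) (Fin 3) L) = S from rfl, Matrix.map_mul, hSmap, Matrix.transpose_mul, hST,
      ← hpermα, ← hconjS α', ← hP']
    simp only [Matrix.mul_assoc]
  · -- `γ₁ (P S) = P D S` and `P S D′ = P S (S D S) = P D S`
    rw [Units.val_mul, show (((⟨S, S, hSS, hSS⟩ : GL (Fin 3) L)) : Matrix (Fin 3) (Fin 3) L) = S from rfl, hγ₁, ← hperme, ← hconjS]
    calc (P : Matrix (Fin 3) (Fin 3) L) * Matrix.diagonal ![e₁, e₂, e₁] * ((P⁻¹ : GL (Fin 3) L) : Matrix (Fin 3) (Fin 3) L) * ((P : Matrix (Fin 3) (Fin 3) L) * S)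
        = (P : Matrix (Fin 3) (Fin 3) L) * Matrix.diagonal ![e₁, e₂, e₁] * (((P⁻¹ : GL (Fin 3) L) : Matrix (Fin 3) (Fin 3) L) * (P : Matrix (Fin 3) (Fin 3) L)) * S := by
          simp only [Matrix.mul_assoc]
      _ = (P : Matrix (Fin 3) (Fin 3) L) * (S * S) * Matrix.diagonal ![e₁, e₂, e₁] * S := by rw [hPinv, hSS, Matrix.mul_one, Matrix.mul_one]
      _ = (P : Matrix (Fin 3) (Fin 3) L) * S * (S * Matrix.diagonal ![e₁, e₂, e₁] * S) := by simp only [Matrix.mul_assoc]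

end Glue

/-! ## §2 Socket #10♯ by name -/

section Frame

variable (L : Type) [Field L] [NumberField L] [IsCMField L]

variable (H' : Matrix (Fin 3) (Fin 3) L) (Tinf : ArchTransferFactor L H')
    -- σ-algebras of the `G′` side (★ (O10-c5) block), of `H_v`, `G_∞`, `H_∞`, and the Haar data — EXACTLY ★ `SingularEllipticTransfer`'s binders
    [∀ g : (UnitaryGroup.cmDatum L 3 H').Adelic, MeasurableSpace ((UnitaryGroup.cmDatum L 3 H').Adelic ⧸ Subgroup.centralizer ({g} : Set (UnitaryGroup.cmDatum L 3 H').Adelic))]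
    [∀ g : (UnitaryGroup.cmDatum L 3 H').Adelic, BorelSpace ((UnitaryGroup.cmDatum L 3 H').Adelic ⧸ Subgroup.centralizer ({g} : Set (UnitaryGroup.cmDatum L 3 H').Adelic))] [∀ γ : UnitaryGroup.arch (↥(maximalRealSubfield L)) L (IsCMField.complexConj L) 3 H',
      MeasurableSpace (UnitaryGroup.arch (↥(maximalRealSubfield L)) L (IsCMField.complexConj L) 3 H' ⧸ Subgroup.centralizer ({γ} : Set (UnitaryGroup.arch (↥(maximalRealSubfield L)) L (IsCMField.complexConj L) 3 H')))] [∀ γ : UnitaryGroup.arch (↥(maximalRealSubfield L)) L (IsCMField.complexConj L) 3 H',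
      BorelSpace (UnitaryGroup.arch (↥(maximalRealSubfield L)) L (IsCMField.complexConj L) 3 H' ⧸ Subgroup.centralizer ({γ} : Set (UnitaryGroup.arch (↥(maximalRealSubfield L)) L (IsCMField.complexConj L) 3 H')))] [∀ (v : HeightOneSpectrum (𝓞 ↥(maximalRealSubfield L))) (γ : (UnitaryGroup.cmDatum L 3 H').Local v),
      MeasurableSpace ((UnitaryGroup.cmDatum L 3 H').Local v ⧸ Subgroup.centralizer ({γ} : Set ((UnitaryGroup.cmDatum L 3 H').Local v)))] [∀ (v : HeightOneSpectrum (𝓞 ↥(maximalRealSubfield L))) (γ : (UnitaryGroup.cmDatum L 3 H').Local v),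
      BorelSpace ((UnitaryGroup.cmDatum L 3 H').Local v ⧸ Subgroup.centralizer ({γ} : Set ((UnitaryGroup.cmDatum L 3 H').Local v)))]
    [∀ v : HeightOneSpectrum (𝓞 ↥(maximalRealSubfield L)), MeasurableSpace ((UnitaryGroup.cmDatum L 3 H').Local v)] [∀ v : HeightOneSpectrum (𝓞 ↥(maximalRealSubfield L)), BorelSpace ((UnitaryGroup.cmDatum L 3 H').Local v)] [MeasurableSpace (UnitaryGroup.cmDatum L 3 H').Adelic] [BorelSpace (UnitaryGroup.cmDatum L 3 H').Adelic]
    [MeasurableSpace (UnitaryGroup.arch (↥(maximalRealSubfield L)) L (IsCMField.complexConj L) 3 H')] [BorelSpace (UnitaryGroup.arch (↥(maximalRealSubfield L)) L (IsCMField.complexConj L) 3 H')]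
    [∀ γ : (UnitaryGroup.cmDatum L 3 H').Adelic, MeasurableSpace (↥(Subgroup.centralizer ({γ} : Set (UnitaryGroup.cmDatum L 3 H').Adelic)) ⧸
      ((UnitaryGroup.cmDatum L 3 H').quotientSubgroup ⊓ Subgroup.centralizer ({γ} : Set (UnitaryGroup.cmDatum L 3 H').Adelic)).subgroupOf (Subgroup.centralizer ({γ} : Set (UnitaryGroup.cmDatum L 3 H').Adelic)))]
    [∀ γ : (UnitaryGroup.cmDatum L 3 H').Adelic, BorelSpace (↥(Subgroup.centralizer ({γ} : Set (UnitaryGroup.cmDatum L 3 H').Adelic)) ⧸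
      ((UnitaryGroup.cmDatum L 3 H').quotientSubgroup ⊓ Subgroup.centralizer ({γ} : Set (UnitaryGroup.cmDatum L 3 H').Adelic)).subgroupOf (Subgroup.centralizer ({γ} : Set (UnitaryGroup.cmDatum L 3 H').Adelic)))]
    [hCcl : ∀ γ : (UnitaryGroup.cmDatum L 3 H').Adelic, IsClosed ((Subgroup.centralizer ({γ} : Set (UnitaryGroup.cmDatum L 3 H').Adelic) : Subgroup (UnitaryGroup.cmDatum L 3 H').Adelic) : Set (UnitaryGroup.cmDatum L 3 H').Adelic)]
    [∀ γ : (UnitaryGroup.cmDatum L 3 H').Adelic, (count : Measure ↥(((UnitaryGroup.cmDatum L 3 H').quotientSubgroup ⊓ Subgroup.centralizer ({γ} : Set (UnitaryGroup.cmDatum L 3 H').Adelic)).subgroupOf (Subgroup.centralizer ({γ} : Set (UnitaryGroup.cmDatum L 3 H').Adelic)))).IsHaarMeasure]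
    [∀ v : HeightOneSpectrum (𝓞 ↥(maximalRealSubfield L)), MeasurableSpace ((UnitaryGroup.cmDatum L 2 (Matrix.of fun i j : Fin 2 => if i.val + j.val + 1 = 2 then (1 : L) else 0)).Local v × (UnitaryGroup.cmDatum L 1 (Matrix.of fun i j : Fin 1 => if i.val + j.val + 1 = 1 then (1 : L) else 0)).Local v)]
    [∀ v : HeightOneSpectrum (𝓞 ↥(maximalRealSubfield L)), BorelSpace ((UnitaryGroup.cmDatum L 2 (Matrix.of fun i j : Fin 2 => if i.val + j.val + 1 = 2 then (1 : L) else 0)).Local v × (UnitaryGroup.cmDatum L 1 (Matrix.of fun i j : Fin 1 => if i.val + j.val + 1 = 1 then (1 : L) else 0)).Local v)]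
    [∀ (v : HeightOneSpectrum (𝓞 ↥(maximalRealSubfield L))) (a : ((UnitaryGroup.cmDatum L 2 (Matrix.of fun i j : Fin 2 => if i.val + j.val + 1 = 2 then (1 : L) else 0)).Local v × (UnitaryGroup.cmDatum L 1 (Matrix.of fun i j : Fin 1 => if i.val + j.val + 1 = 1 then (1 : L) else 0)).Local v)),
      MeasurableSpace (((UnitaryGroup.cmDatum L 2 (Matrix.of fun i j : Fin 2 => if i.val + j.val + 1 = 2 then (1 : L) else 0)).Local v ×
        (UnitaryGroup.cmDatum L 1 (Matrix.of fun i j : Fin 1 => if i.val + j.val + 1 = 1 then (1 : L) else 0)).Local v) ⧸ Subgroup.centralizer ({a} : Set ((UnitaryGroup.cmDatum L 2 (Matrix.of fun i j : Fin 2 => if i.val + j.val + 1 = 2 then (1 : L) else 0)).Local v ×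
        (UnitaryGroup.cmDatum L 1 (Matrix.of fun i j : Fin 1 => if i.val + j.val + 1 = 1 then (1 : L) else 0)).Local v)))] [∀ (v : HeightOneSpectrum (𝓞 ↥(maximalRealSubfield L))) (a : ((UnitaryGroup.cmDatum L 2 (Matrix.of fun i j : Fin 2 => if i.val + j.val + 1 = 2 then (1 : L) else 0)).Local v ×
        (UnitaryGroup.cmDatum L 1 (Matrix.of fun i j : Fin 1 => if i.val + j.val + 1 = 1 then (1 : L) else 0)).Local v)), BorelSpace (((UnitaryGroup.cmDatum L 2 (Matrix.of fun i j : Fin 2 => if i.val + j.val + 1 = 2 then (1 : L) else 0)).Local v ×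
        (UnitaryGroup.cmDatum L 1 (Matrix.of fun i j : Fin 1 => if i.val + j.val + 1 = 1 then (1 : L) else 0)).Local v) ⧸ Subgroup.centralizer ({a} : Set ((UnitaryGroup.cmDatum L 2 (Matrix.of fun i j : Fin 2 => if i.val + j.val + 1 = 2 then (1 : L) else 0)).Local v ×
        (UnitaryGroup.cmDatum L 1 (Matrix.of fun i j : Fin 1 => if i.val + j.val + 1 = 1 then (1 : L) else 0)).Local v)))]
    [MeasurableSpace (UnitaryGroup.arch (↥(maximalRealSubfield L)) L (IsCMField.complexConj L) 3 (Matrix.of fun i j : Fin 3 => if i.val + j.val + 1 = 3 then (1 : L) else 0))] [BorelSpace (UnitaryGroup.arch (↥(maximalRealSubfield L)) L (IsCMField.complexConj L) 3 (Matrix.of fun i j : Fin 3 => if i.val + j.val + 1 = 3 then (1 : L) else 0))]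
    [∀ γ : UnitaryGroup.arch (↥(maximalRealSubfield L)) L (IsCMField.complexConj L) 3 (Matrix.of fun i j : Fin 3 => if i.val + j.val + 1 = 3 then (1 : L) else 0),
      MeasurableSpace (UnitaryGroup.arch (↥(maximalRealSubfield L)) L (IsCMField.complexConj L) 3 (Matrix.of fun i j : Fin 3 => if i.val + j.val + 1 = 3 then (1 : L) else 0) ⧸ Subgroup.centralizer ({γ} : Set (UnitaryGroup.arch (↥(maximalRealSubfield L)) L (IsCMField.complexConj L) 3 (Matrix.of fun i j : Fin 3 => if i.val + j.val + 1 = 3 then (1 : L) else 0))))]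
    [∀ γ : UnitaryGroup.arch (↥(maximalRealSubfield L)) L (IsCMField.complexConj L) 3 (Matrix.of fun i j : Fin 3 => if i.val + j.val + 1 = 3 then (1 : L) else 0),
      BorelSpace (UnitaryGroup.arch (↥(maximalRealSubfield L)) L (IsCMField.complexConj L) 3 (Matrix.of fun i j : Fin 3 => if i.val + j.val + 1 = 3 then (1 : L) else 0) ⧸ Subgroup.centralizer ({γ} : Set (UnitaryGroup.arch (↥(maximalRealSubfield L)) L (IsCMField.complexConj L) 3 (Matrix.of fun i j : Fin 3 => if i.val + j.val + 1 = 3 then (1 : L) else 0))))]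
    [MeasurableSpace (UnitaryGroup.arch (↥(maximalRealSubfield L)) L (IsCMField.complexConj L) 2 (Matrix.of fun i j : Fin 2 => if i.val + j.val + 1 = 2 then (1 : L) else 0) × UnitaryGroup.arch (↥(maximalRealSubfield L)) L (IsCMField.complexConj L) 1 (Matrix.of fun i j : Fin 1 => if i.val + j.val + 1 = 1 then (1 : L) else 0))]
    [BorelSpace (UnitaryGroup.arch (↥(maximalRealSubfield L)) L (IsCMField.complexConj L) 2 (Matrix.of fun i j : Fin 2 => if i.val + j.val + 1 = 2 then (1 : L) else 0) × UnitaryGroup.arch (↥(maximalRealSubfield L)) L (IsCMField.complexConj L) 1 (Matrix.of fun i j : Fin 1 => if i.val + j.val + 1 = 1 then (1 : L) else 0))]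
    [∀ a : (UnitaryGroup.arch (↥(maximalRealSubfield L)) L (IsCMField.complexConj L) 2 (Matrix.of fun i j : Fin 2 => if i.val + j.val + 1 = 2 then (1 : L) else 0) × UnitaryGroup.arch (↥(maximalRealSubfield L)) L (IsCMField.complexConj L) 1 (Matrix.of fun i j : Fin 1 => if i.val + j.val + 1 = 1 then (1 : L) else 0)),
      MeasurableSpace ((UnitaryGroup.arch (↥(maximalRealSubfield L)) L (IsCMField.complexConj L) 2 (Matrix.of fun i j : Fin 2 => if i.val + j.val + 1 = 2 then (1 : L) else 0) ×
          UnitaryGroup.arch (↥(maximalRealSubfield L)) L (IsCMField.complexConj L) 1 (Matrix.of fun i j : Fin 1 => if i.val + j.val + 1 = 1 then (1 : L) else 0)) ⧸ Subgroup.centralizer ({a} : Set (UnitaryGroup.arch (↥(maximalRealSubfield L)) L (IsCMField.complexConj L) 2 (Matrix.of fun i j : Fin 2 => if i.val + j.val + 1 = 2 then (1 : L) else 0) ×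
          UnitaryGroup.arch (↥(maximalRealSubfield L)) L (IsCMField.complexConj L) 1 (Matrix.of fun i j : Fin 1 => if i.val + j.val + 1 = 1 then (1 : L) else 0))))] [∀ a : (UnitaryGroup.arch (↥(maximalRealSubfield L)) L (IsCMField.complexConj L) 2 (Matrix.of fun i j : Fin 2 => if i.val + j.val + 1 = 2 then (1 : L) else 0) ×
          UnitaryGroup.arch (↥(maximalRealSubfield L)) L (IsCMField.complexConj L) 1 (Matrix.of fun i j : Fin 1 => if i.val + j.val + 1 = 1 then (1 : L) else 0)), BorelSpace ((UnitaryGroup.arch (↥(maximalRealSubfield L)) L (IsCMField.complexConj L) 2 (Matrix.of fun i j : Fin 2 => if i.val + j.val + 1 = 2 then (1 : L) else 0) ×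
          UnitaryGroup.arch (↥(maximalRealSubfield L)) L (IsCMField.complexConj L) 1 (Matrix.of fun i j : Fin 1 => if i.val + j.val + 1 = 1 then (1 : L) else 0)) ⧸ Subgroup.centralizer ({a} : Set (UnitaryGroup.arch (↥(maximalRealSubfield L)) L (IsCMField.complexConj L) 2 (Matrix.of fun i j : Fin 2 => if i.val + j.val + 1 = 2 then (1 : L) else 0) ×
          UnitaryGroup.arch (↥(maximalRealSubfield L)) L (IsCMField.complexConj L) 1 (Matrix.of fun i j : Fin 1 => if i.val + j.val + 1 = 1 then (1 : L) else 0))))]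
    (νH : ∀ v : HeightOneSpectrum (𝓞 ↥(maximalRealSubfield L)), Measure ((UnitaryGroup.cmDatum L 2 (Matrix.of fun i j : Fin 2 => if i.val + j.val + 1 = 2 then (1 : L) else 0)).Local v × (UnitaryGroup.cmDatum L 1 (Matrix.of fun i j : Fin 1 => if i.val + j.val + 1 = 1 then (1 : L) else 0)).Local v))
    (νG : ∀ v : HeightOneSpectrum (𝓞 ↥(maximalRealSubfield L)), Measure ((UnitaryGroup.cmDatum L 3 H').Local v)) [∀ v, IsFiniteMeasureOnCompacts (νH v)] [∀ v, (νH v).IsMulRightInvariant]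
    [∀ v, (νG v).IsHaarMeasure] [∀ v, (νG v).IsMulRightInvariant]  -- MAIN-b's strength (F2): `νG_v` Haar
    (νGi : Measure (UnitaryGroup.arch (↥(maximalRealSubfield L)) L (IsCMField.complexConj L) 3 H')) (νqi : Measure (UnitaryGroup.arch (↥(maximalRealSubfield L)) L (IsCMField.complexConj L) 3 (Matrix.of fun i j : Fin 3 => if i.val + j.val + 1 = 3 then (1 : L) else 0)))
    (νHi : Measure (UnitaryGroup.arch (↥(maximalRealSubfield L)) L (IsCMField.complexConj L) 2 (Matrix.of fun i j : Fin 2 => if i.val + j.val + 1 = 2 then (1 : L) else 0) × UnitaryGroup.arch (↥(maximalRealSubfield L)) L (IsCMField.complexConj L) 1 (Matrix.of fun i j : Fin 1 => if i.val + j.val + 1 = 1 then (1 : L) else 0)))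
    [IsFiniteMeasureOnCompacts νGi] [νGi.IsMulRightInvariant] [IsFiniteMeasureOnCompacts νqi] [νqi.IsMulRightInvariant] [IsFiniteMeasureOnCompacts νHi] [νHi.IsMulRightInvariant]

omit
    [∀ g : (UnitaryGroup.cmDatum L 3 H').Adelic, MeasurableSpace ((UnitaryGroup.cmDatum L 3 H').Adelic ⧸ Subgroup.centralizer ({g} : Set (UnitaryGroup.cmDatum L 3 H').Adelic))] [MeasurableSpace (UnitaryGroup.cmDatum L 3 H').Adelic]
    [∀ γ : (UnitaryGroup.cmDatum L 3 H').Adelic, MeasurableSpace (↥(Subgroup.centralizer ({γ} : Set (UnitaryGroup.cmDatum L 3 H').Adelic)) ⧸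
      ((UnitaryGroup.cmDatum L 3 H').quotientSubgroup ⊓ Subgroup.centralizer ({γ} : Set (UnitaryGroup.cmDatum L 3 H').Adelic)).subgroupOf (Subgroup.centralizer ({γ} : Set (UnitaryGroup.cmDatum L 3 H').Adelic)))]
    [∀ g : (UnitaryGroup.cmDatum L 3 H').Adelic, BorelSpace ((UnitaryGroup.cmDatum L 3 H').Adelic ⧸ Subgroup.centralizer ({g} : Set (UnitaryGroup.cmDatum L 3 H').Adelic))] [BorelSpace (UnitaryGroup.cmDatum L 3 H').Adelic]
    [∀ γ : (UnitaryGroup.cmDatum L 3 H').Adelic, BorelSpace (↥(Subgroup.centralizer ({γ} : Set (UnitaryGroup.cmDatum L 3 H').Adelic)) ⧸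
      ((UnitaryGroup.cmDatum L 3 H').quotientSubgroup ⊓ Subgroup.centralizer ({γ} : Set (UnitaryGroup.cmDatum L 3 H').Adelic)).subgroupOf (Subgroup.centralizer ({γ} : Set (UnitaryGroup.cmDatum L 3 H').Adelic)))] hCcl
    [∀ γ : (UnitaryGroup.cmDatum L 3 H').Adelic, (count : Measure ↥(((UnitaryGroup.cmDatum L 3 H').quotientSubgroup ⊓ Subgroup.centralizer ({γ} : Set (UnitaryGroup.cmDatum L 3 H').Adelic)).subgroupOf (Subgroup.centralizer ({γ} : Set (UnitaryGroup.cmDatum L 3 H').Adelic)))).IsHaarMeasure] in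
set_option maxHeartbeats 16000000 in
set_option synthInstance.maxHeartbeats 800000 in
/-- **SOCKET #10♯ `sig_K2E4ExplicitArchConstantPhaseSigned` BY NAME** (statement = `…SigsArchLimitConstant` :324–:381 VERBATIM): for the pinned explicit data and print's
semiregular pair, the archimedean singular-transfer constant satisfies `cinf · Δ‴_∞(γ_H ⊗ 1, γ₀ ⊗ 1) = (−1)^{#{w ∣ ∞ : W₂(γ₀) ⊗_w ℂ definite}} · r` with `r > 0`, together with the
(κ-arch) identity.  Proof: ★ p855349 `explicitArchConstantPhaseSigned_of_signLaw` fed with the «signed #9» obtained from (A) ★ p855819's frame export through (B) ★ p855851 +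
★ `K2E4ArchFramePairSemiregular` and (C) ★ p855849 `signLaw_of_frameExport`.
[cite: Rogawski1990, §8.2 Prop. 8.2.1 (a) p. 118, proof pp. 118–119; §4.9 p. 55; §14.6 p. 242] [cite: Kottwitz1983, §1] [cite: LanglandsShelstad1987, §6.4] -/
theorem explicitArchConstantPhaseSigned :
        ∀ (hK : ∀ v : HeightOneSpectrum (𝓞 ↥(maximalRealSubfield L)), νG v (UnitaryGroup.cmLocalIntegralLevel L 3 H' v : Set ((UnitaryGroup.cmDatum L 3 H').Local v)) = 1) (hanis : ∀ x : Fin 3 → L, hermForm (cmConjRingHom L) H' x x = 0 → x = 0) (Sbad : Finset (HeightOneSpectrum (𝓞 ↥(maximalRealSubfield L))))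
              (Δ : ∀ v : HeightOneSpectrum (𝓞 ↥(maximalRealSubfield L)), LocalTransferFactor L H' v) (mH : ∀ v : HeightOneSpectrum (𝓞 ↥(maximalRealSubfield L)), OrbitalMeasureFamily ((UnitaryGroup.cmDatum L 2 (Matrix.of fun i j : Fin 2 => if i.val + j.val + 1 = 2 then (1 : L) else 0)).Local v ×
                  (UnitaryGroup.cmDatum L 1 (Matrix.of fun i j : Fin 1 => if i.val + j.val + 1 = 1 then (1 : L) else 0)).Local v)) (mG : ∀ v : HeightOneSpectrum (𝓞 ↥(maximalRealSubfield L)), OrbitalMeasureFamily ((UnitaryGroup.cmDatum L 3 H').Local v))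
          (m' : OrbitalMeasureFamily (UnitaryGroup.arch (↥(maximalRealSubfield L)) L (IsCMField.complexConj L) 3 H')) (m : OrbitalMeasureFamily (UnitaryGroup.arch (↥(maximalRealSubfield L)) L (IsCMField.complexConj L) 3 (Matrix.of fun i j : Fin 3 => if i.val + j.val + 1 = 3 then (1 : L) else 0)))
                (mHi : OrbitalMeasureFamily (UnitaryGroup.arch (↥(maximalRealSubfield L)) L (IsCMField.complexConj L) 2 (Matrix.of fun i j : Fin 2 => if i.val + j.val + 1 = 2 then (1 : L) else 0) × UnitaryGroup.arch (↥(maximalRealSubfield L)) L (IsCMField.complexConj L) 1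
                    (Matrix.of fun i j : Fin 1 => if i.val + j.val + 1 = 1 then (1 : L) else 0))) (t' : ∀ γ' : UnitaryGroup.arch (↥(maximalRealSubfield L)) L (IsCMField.complexConj L) 3 H', Measure (Subgroup.centralizer ({γ'} : Set (UnitaryGroup.arch (↥(maximalRealSubfield L)) L (IsCMField.complexConj L) 3 H'))))
                (t : ∀ γ : UnitaryGroup.arch (↥(maximalRealSubfield L)) L (IsCMField.complexConj L) 3 (Matrix.of fun i j : Fin 3 => if i.val + j.val + 1 = 3 then (1 : L) else 0), Measure (Subgroup.centralizer ({γ} : Set (UnitaryGroup.arch (↥(maximalRealSubfield L)) L (IsCMField.complexConj L) 3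
                    (Matrix.of fun i j : Fin 3 => if i.val + j.val + 1 = 3 then (1 : L) else 0))))) (tH : ∀ γH : UnitaryGroup.arch (↥(maximalRealSubfield L)) L (IsCMField.complexConj L) 2 (Matrix.of fun i j : Fin 2 => if i.val + j.val + 1 = 2 then (1 : L) else 0) ×
                    UnitaryGroup.arch (↥(maximalRealSubfield L)) L (IsCMField.complexConj L) 1 (Matrix.of fun i j : Fin 1 => if i.val + j.val + 1 = 1 then (1 : L) else 0), Measure (Subgroup.centralizer ({γH} : Set (UnitaryGroup.arch (↥(maximalRealSubfield L)) L (IsCMField.complexConj L) 2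
                      (Matrix.of fun i j : Fin 2 => if i.val + j.val + 1 = 2 then (1 : L) else 0) × UnitaryGroup.arch (↥(maximalRealSubfield L)) L (IsCMField.complexConj L) 1 (Matrix.of fun i j : Fin 1 => if i.val + j.val + 1 = 1 then (1 : L) else 0))))) (hherm : (H'.map (cmConjRingHom L)).transpose = H')
            (hCTM : CanonicalTransferMatrix L H' Tinf.Δ νH νG Sbad Δ mH mG) (hACS : ArchCanonicalSingularMatrix L H' Tinf νGi νqi νHi hanis m' m mHi t' t tH), ∀ (μ : Literature.NumberTheory.GaloisRepresentations.HeckeCharacter L) (hμu : μ.IsUnitary)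
      (hμω : ∀ x : Literature.NumberTheory.GaloisRepresentations.ideleGroup ↥(maximalRealSubfield L), μ (AdeleRing.ideleBaseChange (↥(maximalRealSubfield L)) L x) = quadraticHeckeCharCM L x) (hΔ : Δ = finExplicitCollection L H' μ (finExplicitDelta_conj_left_all L H' μ) (finExplicitDelta_conj_right_all L H' μ))
      (hTinf : Tinf = archCanonicalTransferFactor L H' μ), ∀ (γ₀ : (UnitaryGroup.cmDatum L 3 H').Rational) (e₁ e₂ : L), e₁ ≠ e₂ →
                ((((γ₀ : unitaryGroup (cmConjRingHom L) H').val : GL (Fin 3) L) : Matrix (Fin 3) (Fin 3) L) - e₁ • (1 : Matrix (Fin 3) (Fin 3) L)) * ((((γ₀ : unitaryGroup (cmConjRingHom L) H').val : GL (Fin 3) L) : Matrix (Fin 3) (Fin 3) L) - e₂ • (1 : Matrix (Fin 3) (Fin 3) L)) = 0 →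
                (¬ ∃ ζ : L, (((γ₀ : unitaryGroup (cmConjRingHom L) H').val : GL (Fin 3) L) : Matrix (Fin 3) (Fin 3) L) = ζ • (1 : Matrix (Fin 3) (Fin 3) L)) → (((γ₀ : unitaryGroup (cmConjRingHom L) H').val : GL (Fin 3) L) : Matrix (Fin 3) (Fin 3) L).charpoly =
                  (Polynomial.X - Polynomial.C e₁) ^ 2 * (Polynomial.X - Polynomial.C e₂) → ∀ (γH : (UnitaryGroup.cmDatum L 2 (Matrix.of fun i j : Fin 2 => if i.val + j.val + 1 = 2 then (1 : L) else 0)).Rational × (UnitaryGroup.cmDatum L 1 (Matrix.of fun i j : Fin 1 => if i.val + j.val + 1 = 1 then (1 : L) else 0)).Rational),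
                  (((γH.1 : unitaryGroup (cmConjRingHom L) (Matrix.of fun i j : Fin 2 => if i.val + j.val + 1 = 2 then (1 : L) else 0)).val : GL (Fin 2) L) : Matrix (Fin 2) (Fin 2) L) = e₁ • (1 : Matrix (Fin 2) (Fin 2) L) →
                  (((γH.2 : unitaryGroup (cmConjRingHom L) (Matrix.of fun i j : Fin 1 => if i.val + j.val + 1 = 1 then (1 : L) else 0)).val : GL (Fin 1) L) : Matrix (Fin 1) (Fin 1) L) 0 0 = e₂ →
                  ∃ cinf : ℂ, (∃ r : ℝ, 0 < r ∧ cinf * Tinf.Δ (cmRationalToArch L 2 (Matrix.of fun i j : Fin 2 => if i.val + j.val + 1 = 2 then (1 : L) else 0) γH.1, cmRationalToArch L 1 (Matrix.of fun i j : Fin 1 => if i.val + j.val + 1 = 1 then (1 : L) else 0) γH.2) (cmRationalToArch L 3 H' γ₀) =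
                    (-1) ^ Set.ncard {w : NumberField.InfinitePlace L | (∀ x : Fin 3 → ℂ, Matrix.mulVec (((((γ₀ : unitaryGroup (cmConjRingHom L) H').val : GL (Fin 3) L) : Matrix (Fin 3) (Fin 3) L)).map w.embedding - w.embedding e₁ • (1 : Matrix (Fin 3) (Fin 3) ℂ)) x = 0 →
                      (∑ i, ∑ j, starRingEnd ℂ (x i) * w.embedding (H' i j) * x j) = 0 → x = 0)} * (r : ℂ)) ∧ (∀ (aH : UnitaryGroup.arch (↥(maximalRealSubfield L)) L (IsCMField.complexConj L) 2 (Matrix.of fun i j : Fin 2 => if i.val + j.val + 1 = 2 then (1 : L) else 0) ×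
                            UnitaryGroup.arch (↥(maximalRealSubfield L)) L (IsCMField.complexConj L) 1 (Matrix.of fun i j : Fin 1 => if i.val + j.val + 1 = 1 then (1 : L) else 0) → ℂ) (a : UnitaryGroup.arch (↥(maximalRealSubfield L)) L (IsCMField.complexConj L) 3 H' → ℂ),
                        ArchSmooth L 3 H' a → ArchSmooth₂ L aH → IsArchDeltaTransfer L H' Tinf mHi m' aH a → archStableOrbitalIntegral L 3 H' (Literature.NumberTheory.Weil1964.UnitaryArchTopForm.archSingularTopFormFamily L H' νGi) a (cmRationalToArch L 3 H' γ₀) =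
                          cinf * aH (cmRationalToArch L 2 (Matrix.of fun i j : Fin 2 => if i.val + j.val + 1 = 2 then (1 : L) else 0) γH.1, cmRationalToArch L 1 (Matrix.of fun i j : Fin 1 => if i.val + j.val + 1 = 1 then (1 : L) else 0) γH.2))
 := by
  intro hK hanis Sbad Δ mH mG m' m mHi t' t tH hherm hCTM hACS μ hμu hμω hΔ hTinf γ₀ e₁ e₂ hne hγ hnsc hchar γH h1 h2
  refine K2E4ExplicitArchConstantPhaseSignedOfSignLaw.explicitArchConstantPhaseSigned_of_signLaw L H' Tinf νH νG νGi νqi νHi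
    hK hanis Sbad Δ mH mG m' m mHi t' t tH hherm hCTM hACS μ hμu hμω hΔ hTinf γ₀ e₁ e₂ hne hγ hnsc hchar γH h1 h2 ?_
  -- (A) the SIGNED #9 assembly with its frame export (K2E4-p09 ★ p855819 over (b) ★ K2E4-p13, (c) ★ p855645∕p855677, hTr ★)
  haveI : νGi.IsHaarMeasure := isHaarMeasure_of_archCanonicalSingularMatrix L H' Tinf νGi νqi νHi hanis m' m mHi t' t tH hherm hACS
  obtain ⟨cinf, ⟨P, α', hP, h₁, h₂, y, s, hy, -, hs, hc⟩, hid⟩ :=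
    K2E4ExplicitArchSingularTransferOfPackagesSigned.explicitArchSingularTransfer_of_packages_signed L H' Tinf νGi νqi νHi
      (fun νw _ z w₁ => Classical.choice (K2E4ArchHStepDataSigned.hStepDataSigned_nonempty L νw z w₁))
      (fun α hα hαh _ _ _ _ T' μω hμu hμω c hc hT' ν _ _ e₁ e₂ h₁ h₂ hne =>
        Classical.choice (K2E4ArchGPrimeDataSigned.gPrimeDataSigned_nonempty L α hα hαh T' μω hμu hμω c hc hT' ν e₁ e₂ h₁ h₂ hne))
      (K2E4ArchSingularTopFormTransport.topFormTransport L H' νGi)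
      hanis m' m mHi t' t tH hherm hACS μ hμu hμω hTinf γ₀ e₁ e₂ hne hγ hnsc hchar γH h1 h2
  refine ⟨cinf, ?_, hid⟩
  -- (B) the rational semiregular element `γ₀′ = P·diag(e₁,e₂,e₁)·P⁻¹` with `y = γ₀′ ⊗ 1` and `h₀ = γ_H ⊗ 1` (K2E4-p13 ★ p855851)
  have hd : ∀ i, (IsCMField.complexConj L (![e₁, e₂, e₁] i) : L) * ![e₁, e₂, e₁] i = 1 := by
    intro i; fin_cases i
    · exact h₁
    · exact h₂
    · exact h₁
  set γ₁ : (UnitaryGroup.cmDatum L 3 H').Rational :=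
    ⟨P * Matrix.GeneralLinearGroup.mkOfDetNeZero (Matrix.diagonal ![e₁, e₂, e₁])
        (K2E4ArchFramePairIdentification.det_diagonal_ne_zero_of_complexConj_mul_self L _ hd) * P⁻¹,
      K2E4ArchFramePairIdentification.conj_diagonal_mem_unitaryGroup L H' P α' hP _ hd⟩ with hγ₁def
  have hγ₁ : (((γ₁ : unitaryGroup (cmConjRingHom L) H').val : GL (Fin 3) L) : Matrix (Fin 3) (Fin 3) L) =
      (P : Matrix (Fin 3) (Fin 3) L) * Matrix.diagonal ![e₁, e₂, e₁] * ((P⁻¹ : GL (Fin 3) L) : Matrix (Fin 3) (Fin 3) L) := rfl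
  have hy' : y = cmRationalToArch L 3 H' γ₁ := by
    apply Subtype.ext
    rw [hy]
    exact (K2E4ArchFramePairIdentification.coe_cmRationalToArch_eq_conj_archDiagTorus L H' P α' ![e₁, e₂, e₁] γ₁ hγ₁ _
      (fun w i => by fin_cases i <;> rfl)).symm
  have h₀ := K2E4ArchFramePairIdentification.hPair_eq_cmRationalToArch L e₁ e₂ h₁ h₂ γH h1 h2
  rw [hy', h₀] at hc
  subst hTinf
  -- the pinned frame `(P·(0 2 1), (α′₀, α′₂, α′₁))` of `γ₀′` and its semiregularity data (§1)
  obtain ⟨hsplit', hnc', hχ'⟩ := semiregular_conj_diagonal L H' P e₁ e₂ hne γ₁ hγ₁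
  obtain ⟨hreal, hne0⟩ := frame_entries_real_ne_zero L H' hherm hanis P α' hP
  have hdσ' : ∀ i, cmConjRingHom L (![α' 0, α' 2, α' 1] i) = ![α' 0, α' 2, α' 1] i := by
    intro i; fin_cases i
    · exact hreal 0
    · exact hreal 2
    · exact hreal 1
  have hd0' : ∀ i, ![α' 0, α' 2, α' 1] i ≠ 0 := by
    intro i; fin_cases i
    · exact hne0 0
    · exact hne0 2
    · exact hne0 1
  obtain ⟨P', hHP', hγP'⟩ := frame_perm L H' P α' hP e₁ e₂ γ₁ hγ₁
  -- (C) the conversion (this seat ★ p855849) at `γ₀′` with that frame: `d 0 * d 1 = α′ 0 * α′ 2` and `Tinf.Δ = archCanonicalDelta` by `rfl`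
  exact K2E4SignedNineOfFrameExport.signLaw_of_frameExport L H' hherm hanis γ₁ hne hsplit' hnc' hχ' γH h1 h2 hdσ' hd0' hHP' hγP' μ cinf s hs hc

end Frame

end Summit.HodgeConjecture.HodgeConjecture.Cruxes.H413.K2E4ExplicitArchConstantPhaseSigned

end
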